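import Summits.BirchSwinnertonDyer.BirchSwinnertonDyer.Theorems.EisensteinPrimesB11L3MainConjecture
import Summits.BirchSwinnertonDyer.BirchSwinnertonDyer.Theorems.EisensteinPrimesB11L3Cert19740v1
import HarnessLib

/-!
# Row B11, ψ-EVEN split cell `19740v1@3`: the SAME L3 certificate gives `BSD(19740v1, 3)` AND MAZUR'S MAIN
# CONJECTURE at `(19740v1, 3)` — a pair where no published theorem supplies the main conjecture
# (cell `bsd-eis`, seat `bsd-eis-k5-p3` gen 2; crux 4 `BSDpOnCellC` = stmt-BirchSwinnertonDyer-19034; THEOREMS ONLY)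

HONEST FRAMING (FULL-BSD rank-≤1 programme D-0033, cell `bsd-eis`). Nothing is booked here and no label or
count moves; X2c stays CONSTRUCTION-SHAPED; BSD and the main conjecture are proved for no curve unconditionally.
`19740v1 = [0, 1, 0, −5045, 83100]`, `N = 19740 = 2²·3·5·7·47`, split multiplicative at `3`, `E[3]` reducible,
sub-cell `split-notGV` (ψ-even: Greenberg–Vatsal's parity hypothesis FAILS, so `GV00` gives nothing here; the only
printed source of the main conjecture at such a pair is the Keller–Yin preprint). Kernel membership (`classX2_19740v1`,
`split_19740v1`) is `Theorems/EisensteinPrimesB11L3Cert19740v1.lean` (p544152); the door is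
`B11L3.bsdp_and_mazurMainConjectureAt_of_cellC_of_split_of_thm16_of_l3Certificate`
(`Theorems/EisensteinPrimesB11L3MainConjecture.lean`): Wuthrich 2014 Thm. 16 run through the pair's two readings
(`ord_{T=0} L = 2`, `v₃(ϖ·[T²]L·log₃(γ)²·#tors²) = v₃(𝓛₃·∏c_v·Reg₃)`) makes the Kato cofactor a unit of `Λ`.
Instrument readings of record for this pair («B11-L3CW», `HOME/k5-p3-g2/`): heights REG-MULT kit j282121–5
(`v₃(Reg₃) = −1` both engines, 23 digits; `v₃(𝓛₃) = 2`), engine B j282308 ‖ engine C j282484 (`v₃(ϖ[T²]L) = 1`, exact at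
levels 3 and 4; `(μ,λ) = (0,4)`), atoms `#tors = 6`, `∏c_v = 324`, `#Ш_an = 1` — identity `2 + 2·1 + 1 = 1·2 + 4 + (−1)` ✓
(ERRATUM to the first filing p547575, which printed `v₃(Reg₃) = 1` and `2 + 4 + 1` here; kernel content unchanged).
CLASS-LEVEL INPUTS BY NAME [PUB]: `hWu` Wuthrich 2014 Thm. 16, `hJs` Stein–Wuthrich 2013 Thm. 6.1 (split),
`hGZ` Gross–Zagier I.7.3, `hGZK`, `hpar`. No GV fact, no `_OPEN` fact, no preprint.
Refs: [Wuthrich2014] Thm. 16 (p. 397); [SteinWuthrich2013] Thm. 6.1 (p. 20), §4.2, §8.2 (p. 24); [Miller2011LMS] Def. 1.1.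
-/

set_option autoImplicit false
set_option linter.dupNamespace false

noncomputable section

open scoped Classical MatrixGroups ModularForm

open WeierstrassCurve PowerSeries CongruenceSubgroup
  Literature.NumberTheory.EllipticCurves
  Literature.NumberTheory.EllipticCurves.ModularForms
  Literature.NumberTheory.EllipticCurves.Rank1Residual
  Literature.NumberTheory.EllipticCurves.Rank1Residual.Typed
  Literature.NumberTheory.EllipticCurves.Wuthrich2014
  Literature.NumberTheory.EllipticCurves.SteinWuthrich2013
  Summit.BirchSwinnertonDyer.Rank1Residual
  Summit.BirchSwinnertonDyer.Rank1Residual.X2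
  Summit.BirchSwinnertonDyer.BirchSwinnertonDyer.Theorems.B11L3
  Summit.BirchSwinnertonDyer.BirchSwinnertonDyer.Theorems.B11L3Cert19740v1

namespace Summit.BirchSwinnertonDyer.BirchSwinnertonDyer.Theorems.B11L3MC19740v1

/-- **`BSD(19740v1, 3)` AND Mazur's main conjecture at `(19740v1, 3)`** (ψ-even split Eisenstein pair,
rank one) from Wuthrich Thm. 16 + Stein–Wuthrich Thm. 6.1 + GZK and the pair's L3 certificate — ONE
certificate, two conclusions; no parity, no `(μ,λ)`, no partner. CONDITIONAL on the readings `hr`, `hcert`,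
`hsha` (the main-conjecture conjunct does not use `hsha`). [cite: Wuthrich2014, Thm. 16 (p. 397)]
[cite: SteinWuthrich2013, Thm. 6.1 (p. 20), §4.2 and §8.2 (p. 24)] [cite: Miller2011LMS, Def. 1.1 and Prop. 7.6] -/
theorem bsdp_and_mazurMainConjectureAt_19740v1_at_three_l3
    (hWu : thm16_charIdeal_dvd_multiplicative_of_reducible) (hJs : thm61_splitMultiplicative)
    (hGZ : GrossZagier1986_thm_I_7_3) (hGZK : rank_eq_analyticRank_of_analyticRank_le_one)
    (hpar : nonempty_modularParametrizationData)
    (W : WeierstrassCurve ℚ) [W.IsElliptic] [W.IsGloballyMinimal] (hW : W = ⟨0, 1, 0, (-5045), 83100⟩)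
    (hr : W.analyticRank = 1)
    (hcert : ∀ {N : ℕ} [NeZero N] (f : CuspForm (Gamma0 N) 2), IsNewformOf W f →
      ∀ (ϖ : ℚ), (ϖ : ℝ) * W.realPeriodRat = plusPeriod f →
      ∀ (L : PowerSeries ℚ_[3]), IsSplitMultPAdicLFunctionOf f 3 L →
      ∀ (Dq : TateParameterData W 3) (Dh : PAdicHeightData W 3), IsSplitMultCanonical Dh Dq →
        L.order = ((2 : ℕ) : ℕ∞) ∧
        (((ϖ : ℚ) : ℚ_[3]) * PowerSeries.coeff 2 L *
            (padicLog 3 (cyclotomicGenerator 3) ^ 2 * (W.torsionOrder : ℚ_[3]) ^ 2)).valuation =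
          (LInvariant Dq * (W.tamagawaProduct : ℚ_[3]) * padicRegulator Dh).valuation)
    (hsha : ∀ s : ℚ, shaAn W = (s : ℂ) → padicValRat 3 s = 0) :
    BSDp W 3 ∧ X2.MazurMainConjectureAt W 3 := by
  subst hW
  exact bsdp_and_mazurMainConjectureAt_of_cellC_of_split_of_thm16_of_l3Certificate _ 3 hWu hJs hGZ hGZK
    hpar ⟨hr, classX2_19740v1⟩ split_19740v1 hcert hsha

/-- **Mazur's main conjecture at `(19740v1, 3)` alone, without the `#Ш_an` reading.**
[cite: Wuthrich2014, Thm. 16 (p. 397)] [cite: SteinWuthrich2013, Thm. 6.1 (p. 20) and §8.2 (p. 24)] -/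
theorem mazurMainConjectureAt_19740v1_at_three_l3
    (hWu : thm16_charIdeal_dvd_multiplicative_of_reducible) (hJs : thm61_splitMultiplicative)
    (hGZK : rank_eq_analyticRank_of_analyticRank_le_one)
    (W : WeierstrassCurve ℚ) [W.IsElliptic] [W.IsGloballyMinimal] (hW : W = ⟨0, 1, 0, (-5045), 83100⟩)
    (hr : W.analyticRank = 1)
    (hcert : ∀ {N : ℕ} [NeZero N] (f : CuspForm (Gamma0 N) 2), IsNewformOf W f →
      ∀ (ϖ : ℚ), (ϖ : ℝ) * W.realPeriodRat = plusPeriod f →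
      ∀ (L : PowerSeries ℚ_[3]), IsSplitMultPAdicLFunctionOf f 3 L →
      ∀ (Dq : TateParameterData W 3) (Dh : PAdicHeightData W 3), IsSplitMultCanonical Dh Dq →
        L.order = ((2 : ℕ) : ℕ∞) ∧
        (((ϖ : ℚ) : ℚ_[3]) * PowerSeries.coeff 2 L *
            (padicLog 3 (cyclotomicGenerator 3) ^ 2 * (W.torsionOrder : ℚ_[3]) ^ 2)).valuation =
          (LInvariant Dq * (W.tamagawaProduct : ℚ_[3]) * padicRegulator Dh).valuation) :
    X2.MazurMainConjectureAt W 3 := by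
  subst hW
  exact cellC_mazurMainConjectureAt_of_split_of_thm16_of_l3Certificate _ 3 hWu hJs hGZK
    ⟨hr, classX2_19740v1⟩ split_19740v1 hcert

end Summit.BirchSwinnertonDyer.BirchSwinnertonDyer.Theorems.B11L3MC19740v1

end
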